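import Literature.RepresentationTheory.HeisenbergGroup.LocalWeilProjective
import Literature.RepresentationTheory.HeisenbergGroup.SchrodingerModel
import HarnessLib

/-!
# The Schrödinger model of the OPPOSITE pairing `-β` is the complex conjugate of that of `β`; implementers transport
# by conjugation

Topic `RepresentationTheory/HeisenbergGroup`; namespace `Literature.RepresentationTheory.HeisenbergGroup`.  KERNEL ONLY:
definitions with bodies + theorems; no record, no named fact, no `sorry`.

For a pairing `β : X →ₗ[R] Y →ₗ[R] R` and a unitary character `ψ : AddChar R Circle`:

* §1 `Heisenberg.negPolarEquiv β : Heisenberg (polar β) ≃* Heisenberg (polar (-β))`, `(w, t) ↦ (w, -t)` — the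
  Heisenberg groups of a symplectic space and of its opposite are isomorphic (the symplectic space `𝕎⁻ = (𝕎, -⟨,⟩)`
  of the doubling method); `PseudoSymplectic.negPolar : B₀(polar β) →* B₀(polar (-β))`, `(σ, f) ↦ (σ, -f)`, compatible
  with the actions (`negPolarEquiv_act`); the symplectic groups coincide (`symplecticGroupNegEquiv`, same underlying
  linear map) and Weil's sections correspond (`negPolar_ofSymplectic`);
* §2 **`conj_schrodinger`**: `conj ∘ (ρ_β(h) f) = ρ_{-β}(negPolarEquiv h) (conj ∘ f)` on all functions `X → ℂ`
  (`conj ψ(a) = ψ(-a)`), and the same on Schwartz–Bruhat functions (`conjSB`, `conjSB_schrodingerSB`);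
* §3 **implementers**: for a `ℂ`-linear automorphism `M` of `𝒮(X)`, the conjugate `conjOp M = conj ∘ M ∘ conj` is
  `ℂ`-linear, and **`Implements ρ_β s M → Implements ρ_{-β} (negPolar s) (conjOp M)`** (`implements_conjOp`); at the
  level of MVW's groups of pairs: `(g, M) ∈ S̃p_ψ(𝕎, β) → (g, conjOp M) ∈ S̃p_ψ(𝕎, -β)` (`conjOp_mem_MpPsi`).

This is the elementary identity behind «the Weil representation of `𝕎⁻` is the contragredient / complex conjugate of
that of `𝕎`» ([MoeglinVignerasWaldspurger1987, Chap. 2 II.1 Remarque; Chap. 4 II.1]; [HarrisKudlaSweet1996, §1 (1.4)]: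
`ω_{V,χ}` on `W⁻ = (W, -⟨,⟩)` realised on `S̄`), read on the tree's polarised models `schrodinger β ψ` /
`schrodingerSB β ψ` (`SchrodingerModel.lean`) and groups of pairs `MpPsi` (`LocalWeilProjective.lean`).

Written for the cell `hodgecm-mathlib` (fan B, rung B-IV, KEY `b4-howe-compact-irreducible`, node E3 of the doubling
proof of `MoeglinVignerasWaldspurger1987.mvw_IV4_rankOne_irreducibleOrZero`: the doubled local Schrödinger model of
`U(V ⊕ V⁻)` is `ρ_{T₀} ⊠ ρ_{-T₀}` on `𝒮(F_vⁿ) ⊗ 𝒮(F_vⁿ)`, and the second factor's implementers are the conjugates of the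
first factor's — so that `conj f₂` is an eigenvector of the centre whenever `f₂` is).  Nothing about theta lifts is
asserted here.

## References
* [MoeglinVignerasWaldspurger1987] C. Mœglin, M.-F. Vignéras, J.-L. Waldspurger, LNM 1291 (1987), Chap. 2 I.4 Exemple (1),
  II.1 (A); Chap. 4 II.1.
* [HarrisKudlaSweet1996] M. Harris, S. Kudla, W. Sweet, J. AMS 9 (1996), §1 (1.4).
* [Weil1964] A. Weil, Acta Math. 111 (1964), Chap. I n° 4–5.
-/

set_option autoImplicit false

noncomputable section

open scoped ComplexConjugate
open Literature.NumberTheory.Automorphic (SchwartzBruhat mem_schwartzBruhat_iff)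

namespace Literature.RepresentationTheory.HeisenbergGroup

universe u v

section Algebra

variable {R : Type u} [CommRing R] {X Y : Type v} [AddCommGroup X] [Module R X] [AddCommGroup Y] [Module R Y]
  (β : X →ₗ[R] Y →ₗ[R] R)

/-! ## §1 The Heisenberg group, Weil's group `B₀` and the symplectic group of the opposite pairing -/

/-- **`(w, t) ↦ (w, -t)` is an isomorphism `Heisenberg (polar β) ≃* Heisenberg (polar (-β))`**.
[cite: MoeglinVignerasWaldspurger1987, Chap. 2 I.1] -/
def Heisenberg.negPolarEquiv : Heisenberg (polar β) ≃* Heisenberg (polar (-β)) where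
  toFun a := ⟨a.v, -a.t⟩
  invFun a := ⟨a.v, -a.t⟩
  left_inv a := Heisenberg.ext rfl (neg_neg a.t)
  right_inv a := Heisenberg.ext rfl (neg_neg a.t)
  map_mul' a b := by
    refine Heisenberg.ext rfl ?_
    show -((a * b).t) = -a.t + -b.t + polar (-β) a.v b.v
    simp only [Heisenberg.mul_t, polar_apply, LinearMap.neg_apply]
    ring

/-- components. [cite: MoeglinVignerasWaldspurger1987, Chap. 2 I.1] -/
@[simp] theorem Heisenberg.negPolarEquiv_v (a : Heisenberg (polar β)) : (Heisenberg.negPolarEquiv β a).v = a.v := rfl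
/-- components. [cite: MoeglinVignerasWaldspurger1987, Chap. 2 I.1] -/
@[simp] theorem Heisenberg.negPolarEquiv_t (a : Heisenberg (polar β)) : (Heisenberg.negPolarEquiv β a).t = -a.t := rfl
/-- components of the inverse. [cite: MoeglinVignerasWaldspurger1987, Chap. 2 I.1] -/
@[simp] theorem Heisenberg.negPolarEquiv_symm_v (a : Heisenberg (polar (-β))) :
    ((Heisenberg.negPolarEquiv β).symm a).v = a.v := rfl
/-- components of the inverse. [cite: MoeglinVignerasWaldspurger1987, Chap. 2 I.1] -/
@[simp] theorem Heisenberg.negPolarEquiv_symm_t (a : Heisenberg (polar (-β))) :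
    ((Heisenberg.negPolarEquiv β).symm a).t = -a.t := rfl

/-- **`(σ, f) ↦ (σ, -f)` maps Weil's group `B₀(polar β)` to `B₀(polar (-β))`** (a homomorphism).
[cite: Weil1964, n° 5 (6)–(7), p. 150] -/
def Heisenberg.PseudoSymplectic.negPolar :
    Heisenberg.PseudoSymplectic (polar β) →* Heisenberg.PseudoSymplectic (polar (-β)) where
  toFun s :=
    { σ := s.σ
      f := fun w => -s.f w
      cocycle := by
        intro w₁ w₂
        rw [s.cocycle w₁ w₂]
        simp only [polar_apply, LinearMap.neg_apply]
        ring }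
  map_one' := by
    apply Heisenberg.PseudoSymplectic.ext
    · rfl
    · funext w
      show -((1 : Heisenberg.PseudoSymplectic (polar β)).f w) = 0
      rw [show (1 : Heisenberg.PseudoSymplectic (polar β)).f w = 0 from rfl, neg_zero]
  map_mul' s s' := by
    apply Heisenberg.PseudoSymplectic.ext
    · rfl
    · funext w
      show -((s * s').f w) = -(s'.f w) + -(s.f (s'.σ w))
      rw [Heisenberg.PseudoSymplectic.mul_f, neg_add]

/-- components. [cite: Weil1964, n° 5, p. 150] -/
@[simp] theorem Heisenberg.PseudoSymplectic.negPolar_σ (s : Heisenberg.PseudoSymplectic (polar β)) :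
    (Heisenberg.PseudoSymplectic.negPolar β s).σ = s.σ := rfl
/-- components. [cite: Weil1964, n° 5, p. 150] -/
@[simp] theorem Heisenberg.PseudoSymplectic.negPolar_f (s : Heisenberg.PseudoSymplectic (polar β)) (w : X × Y) :
    (Heisenberg.PseudoSymplectic.negPolar β s).f w = -s.f w := rfl

/-- **compatibility with the actions**: `negPolarEquiv (s · a) = (negPolar s) · (negPolarEquiv a)`.
[cite: Weil1964, n° 5, p. 150] -/
theorem Heisenberg.negPolarEquiv_act (s : Heisenberg.PseudoSymplectic (polar β)) (a : Heisenberg (polar β)) :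
    Heisenberg.negPolarEquiv β (s.act a) = (Heisenberg.PseudoSymplectic.negPolar β s).act (Heisenberg.negPolarEquiv β a) := by
  refine Heisenberg.ext rfl ?_
  show -(a.t + s.f a.v) = -a.t + -s.f a.v
  rw [neg_add]

/-- the symplectic groups of `polar β` and `polar (-β)` have the same elements. [cite: Weil1964, n° 5, p. 150] -/
theorem mem_symplecticGroup_neg_iff (g : (X × Y) ≃ₗ[R] (X × Y)) :
    g ∈ symplecticGroup (polar (-β)) ↔ g ∈ symplecticGroup (polar β) := by
  simp only [mem_symplecticGroup, polar_apply, LinearMap.neg_apply]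
  constructor
  · intro h w w'
    have := h w w'
    linear_combination -this
  · intro h w w'
    have := h w w'
    linear_combination -this

/-- **`Sp(polar β) ≃* Sp(polar (-β))`**, the identity on underlying linear maps. [cite: Weil1964, n° 5, p. 150] -/
def symplecticGroupNegEquiv : symplecticGroup (polar β) ≃* symplecticGroup (polar (-β)) where
  toFun g := ⟨g.1, (mem_symplecticGroup_neg_iff β g.1).2 g.2⟩
  invFun g := ⟨g.1, (mem_symplecticGroup_neg_iff β g.1).1 g.2⟩
  left_inv _ := rfl
  right_inv _ := rfl
  map_mul' _ _ := rfl

/-- underlying map. [cite: Weil1964, n° 5, p. 150] -/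
@[simp] theorem symplecticGroupNegEquiv_coe (g : symplecticGroup (polar β)) :
    ((symplecticGroupNegEquiv β g : symplecticGroup (polar (-β))) : (X × Y) ≃ₗ[R] (X × Y)) = g.1 := rfl

/-- **Weil's sections correspond**: `negPolar (ofSymplectic (polar β) g) = ofSymplectic (polar (-β)) g`.
[cite: Weil1964, n° 5, pp. 150–151] -/
theorem Heisenberg.PseudoSymplectic.negPolar_ofSymplectic [Invertible (2 : R)] (g : symplecticGroup (polar β)) :
    Heisenberg.PseudoSymplectic.negPolar β (ofSymplectic (polar β) g) =
      ofSymplectic (polar (-β)) (symplecticGroupNegEquiv β g) := by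
  apply Heisenberg.PseudoSymplectic.ext
  · rfl
  · funext w
    rw [Heisenberg.PseudoSymplectic.negPolar_f, ofSymplectic_f, ofSymplectic_f]
    simp only [polar_apply, LinearMap.neg_apply, symplecticGroupNegEquiv_coe]
    ring

/-! ## §2 Complex conjugation intertwines `ρ_β` and `ρ_{-β}` -/

variable (ψ : AddChar R Circle)

/-- `conj (ψ a) = ψ (-a)` in `ℂ`. [cite: MoeglinVignerasWaldspurger1987, Chap. 2 I.2] -/
theorem conj_coe_addChar (a : R) : conj ((ψ a : Circle) : ℂ) = ((ψ (-a) : Circle) : ℂ) := by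
  rw [AddChar.map_neg_eq_inv, Circle.coe_inv_eq_conj]

/-- **`conj ∘ (ρ_β(h) f) = ρ_{-β}(negPolarEquiv h) (conj ∘ f)`** on all functions `X → ℂ`: the Schrödinger model of the
opposite pairing is the complex conjugate of the Schrödinger model. [cite: MoeglinVignerasWaldspurger1987, Chap. 2 I.4 Exemple (1)] -/
theorem conj_schrodinger (h : Heisenberg (polar β)) (f : X → ℂ) :
    (fun u => conj (schrodinger β ψ h f u)) = schrodinger (-β) ψ (Heisenberg.negPolarEquiv β h) (fun u => conj (f u)) := by
  funext u
  rw [schrodinger_apply, schrodinger_apply, map_mul, conj_coe_addChar]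
  simp only [Heisenberg.negPolarEquiv_t, Heisenberg.negPolarEquiv_v, LinearMap.neg_apply, neg_add]

end Algebra

/-! ## §3 Schwartz–Bruhat functions and implementers -/

section Conj

variable {X : Type v} [TopologicalSpace X]

/-- **complex conjugation on `𝒮(X)`** (pointwise; preserves local constancy and compact support).
[cite: MoeglinVignerasWaldspurger1987, Chap. 2 I.4 Exemple (1)] -/
def conjSB (f : SchwartzBruhat X) : SchwartzBruhat X :=
  ⟨fun u => conj ((f : X → ℂ) u), by
    obtain ⟨hlc, hcs⟩ := mem_schwartzBruhat_iff.1 f.2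
    exact mem_schwartzBruhat_iff.2 ⟨hlc.comp _, hcs.comp_left (map_zero _)⟩⟩

/-- pointwise formula. [cite: MoeglinVignerasWaldspurger1987, Chap. 2 I.4 Exemple (1)] -/
@[simp] theorem coe_conjSB_apply (f : SchwartzBruhat X) (u : X) : ((conjSB f : SchwartzBruhat X) : X → ℂ) u = conj ((f : X → ℂ) u) :=
  rfl

/-- `conjSB` is an involution. [cite: MoeglinVignerasWaldspurger1987, Chap. 2 I.4 Exemple (1)] -/
@[simp] theorem conjSB_conjSB (f : SchwartzBruhat X) : conjSB (conjSB f) = f := by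
  apply Subtype.ext; funext u; simp

/-- `conjSB` is additive. [cite: MoeglinVignerasWaldspurger1987, Chap. 2 I.4 Exemple (1)] -/
theorem conjSB_add (f g : SchwartzBruhat X) : conjSB (f + g) = conjSB f + conjSB g := by
  apply Subtype.ext; funext u; simp

/-- `conjSB` is conjugate-linear. [cite: MoeglinVignerasWaldspurger1987, Chap. 2 I.4 Exemple (1)] -/
theorem conjSB_smul (c : ℂ) (f : SchwartzBruhat X) : conjSB (c • f) = conj c • conjSB f := by
  apply Subtype.ext; funext u; simp

/-- **the conjugate `conj ∘ M ∘ conj` of a `ℂ`-linear automorphism of `𝒮(X)`**, again `ℂ`-linear.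
[cite: MoeglinVignerasWaldspurger1987, Chap. 2 II.1 (A)] -/
def conjOp (M : SchwartzBruhat X ≃ₗ[ℂ] SchwartzBruhat X) : SchwartzBruhat X ≃ₗ[ℂ] SchwartzBruhat X where
  toFun f := conjSB (M (conjSB f))
  invFun f := conjSB (M.symm (conjSB f))
  map_add' f g := by rw [conjSB_add, map_add, conjSB_add]
  map_smul' c f := by rw [conjSB_smul, map_smul, conjSB_smul, RingHom.id_apply, Complex.conj_conj]
  left_inv f := by simp
  right_inv f := by simp

/-- formula. [cite: MoeglinVignerasWaldspurger1987, Chap. 2 II.1 (A)] -/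
@[simp] theorem conjOp_apply (M : SchwartzBruhat X ≃ₗ[ℂ] SchwartzBruhat X) (f : SchwartzBruhat X) :
    conjOp M f = conjSB (M (conjSB f)) := rfl

end Conj

section SB

variable {R : Type u} [CommRing R] [TopologicalSpace R] [ContinuousNeg R] {X Y : Type v} [AddCommGroup X] [Module R X]
  [AddCommGroup Y] [Module R Y] [TopologicalSpace X] [IsTopologicalAddGroup X]
  {β : X →ₗ[R] Y →ₗ[R] R} {ψ : AddChar R Circle} (hl : IsLocallyConstant (⇑ψ : R → Circle))
  (hb : ∀ y : Y, Continuous fun u : X => β u y)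

omit [IsTopologicalAddGroup X] in
include hb in
/-- continuity of `(-β)(·, y)`. [cite: MoeglinVignerasWaldspurger1987, Chap. 2 I.4 Exemple (1)] -/
theorem continuous_neg_pairing_left (y : Y) : Continuous fun u : X => (-β) u y := by
  simp only [LinearMap.neg_apply]
  exact (hb y).neg

/-- **`conj (ρ_β(h) f) = ρ_{-β}(negPolarEquiv h)(conj f)` on `𝒮(X)`**. [cite: MoeglinVignerasWaldspurger1987, Chap. 2 I.4 Exemple (1)] -/
theorem conjSB_schrodingerSB (h : Heisenberg (polar β)) (f : SchwartzBruhat X) :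
    conjSB (schrodingerSB β ψ hl hb h f) =
      schrodingerSB (-β) ψ hl (continuous_neg_pairing_left hb) (Heisenberg.negPolarEquiv β h) (conjSB f) := by
  apply Subtype.ext
  change (fun u => conj (schrodinger β ψ h (f : X → ℂ) u)) = schrodinger (-β) ψ (Heisenberg.negPolarEquiv β h) _
  rw [conj_schrodinger]
  rfl

/-- the same read from the opposite side: `conj (ρ_{-β}(h') f) = ρ_β(negPolarEquiv⁻¹ h')(conj f)`.
[cite: MoeglinVignerasWaldspurger1987, Chap. 2 I.4 Exemple (1)] -/
theorem conjSB_schrodingerSB_neg (h' : Heisenberg (polar (-β))) (f : SchwartzBruhat X) :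
    conjSB (schrodingerSB (-β) ψ hl (continuous_neg_pairing_left hb) h' f) =
      schrodingerSB β ψ hl hb ((Heisenberg.negPolarEquiv β).symm h') (conjSB f) := by
  have h := conjSB_schrodingerSB hl hb ((Heisenberg.negPolarEquiv β).symm h') (conjSB f)
  rw [MulEquiv.apply_symm_apply, conjSB_conjSB] at h
  rw [← h, conjSB_conjSB]

/-- **if `M` implements `s` on `ρ_β`, then `conj ∘ M ∘ conj` implements `negPolar s` on `ρ_{-β}`**.
[cite: MoeglinVignerasWaldspurger1987, Chap. 2 II.1 (A)] -/
theorem implements_conjOp {s : Heisenberg.PseudoSymplectic (polar β)} {M : SchwartzBruhat X ≃ₗ[ℂ] SchwartzBruhat X}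
    (hM : Implements (schrodingerSB β ψ hl hb) s M) :
    Implements (schrodingerSB (-β) ψ hl (continuous_neg_pairing_left hb)) (Heisenberg.PseudoSymplectic.negPolar β s)
      (conjOp M) := by
  intro h' f
  rw [conjOp_apply, conjOp_apply, conjSB_schrodingerSB_neg hl hb, hM, conjSB_schrodingerSB hl hb,
    Heisenberg.negPolarEquiv_act, MulEquiv.apply_symm_apply]

/-- **at the level of MVW's groups of pairs**: `(g, M) ∈ S̃p_ψ(β) → (g, conj ∘ M ∘ conj) ∈ S̃p_ψ(-β)` (same symplectic
element, read in `Sp(polar (-β))`). [cite: MoeglinVignerasWaldspurger1987, Chap. 2 II.1 (A)] -/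
theorem conjOp_mem_MpPsi [Invertible (2 : R)] {g : symplecticGroup (polar β)} {M : SchwartzBruhat X ≃ₗ[ℂ] SchwartzBruhat X}
    (hM : (g, M) ∈ MpPsi (schrodingerSB β ψ hl hb)) :
    (symplecticGroupNegEquiv β g, conjOp M) ∈ MpPsi (schrodingerSB (-β) ψ hl (continuous_neg_pairing_left hb)) := by
  rw [mem_MpPsi] at hM ⊢
  rw [← Heisenberg.PseudoSymplectic.negPolar_ofSymplectic]
  exact implements_conjOp hl hb hM

end SB

end Literature.RepresentationTheory.HeisenbergGroup

end
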